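import Literature.Computability.Complexity.ExtMonotoneCircuits
import Literature.Computability.Complexity.CircuitSemantics
import Mathlib.LinearAlgebra.Matrix.PosDef
import Mathlib.LinearAlgebra.Matrix.Trace
import Mathlib.Data.Matrix.Block
import Mathlib.Data.Matrix.Basis
import Mathlib.Algebra.Order.Star.Real

/-!
# PneNP / ConvexRankGates — collapse of `{∧₂, ∨₂} ∪ CONV` circuits to ONE CONV gate, I

Helper development for the crux `ConvexGateBlind` (item `stmt-PneNP-10680`) of route
`ConvexRankGates` (a `--supports` file; it closes nothing by itself). The route's informal text
asserts that `{∧₂, ∨₂} ∪ CONV` circuits "collapse to ONE poly-size CONV gate" (the SDP-feasibility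
analogue of the max-existential weak-MLP representation of MLP circuits, Oliveira–Pudlák 2019,
Thm. 4.3 / §7); this file and its sequel PROVE it.

The single system of a circuit whose gates are CONV gates with data
`(p j, q j, A j, b j, B j)`: one psd matrix variable `𝒴`; for every gate `j` a `Y`-block (read
through coordinates `eY j`), a level scalar `z_j = 𝒴 (vZ j) (vZ j)` and linearised products
`w_{j,u} = 𝒴 (vW j u) (vW j u)` for every wire `u` (an input or a gate); rows: the HOMOGENISED gate
rows `tr (A^j_r Y_j) ≤ b^j_r z_j + ∑ₐ B^j_{ra} w_{j,u_a}`, the rows `w_{j,u} ≤ z_j`, `w_{j,e} ≤ [x_e]`,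
`w_{j,m} ≤ z_m`, and the output row `z_out ≥ 1`.

* `isConvGate_of_indexed` — CONV data over arbitrary finite index types give `IsConvGate`;
* `posSemidef_blockDiagonal` — block-diagonal matrices with psd blocks are psd;
* `ConvCollapse.eval_of_levels` — SOUNDNESS, for abstract coordinates: a psd `𝒴` satisfying the
  rows forces the circuit to accept (strong induction along the program: a gate of positive level
  is true — divide its block by `z_j > 0`; `w_{j,u}/z_j ≤ [u]` since false gates have level `0`);
* `ConvCollapse.exists_feasible` — COMPLETENESS on the concrete coordinates
  `Fin (Q+1) × (gates ⊕ (gates ⊕ gates × wires))`: the block-diagonal point (witnesses of the true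
  gates, levels `[gate true]`, products `[gate true ∧ wire true]`) satisfies all rows.
-/

namespace Summit.PneNP.PneNP.Theorems

open Literature.Computability.Complexity Matrix Finset

/-- The trace is invariant under simultaneous reindexing of rows and columns along an
equivalence. [folklore] -/
theorem trace_submatrix_of_equiv {m n R : Type*} [Fintype m] [Fintype n] [AddCommMonoid R]
    (M : Matrix n n R) (e : m ≃ n) : (M.submatrix e e).trace = M.trace := by
  simp only [Matrix.trace, Matrix.diag_apply, Matrix.submatrix_apply]
  exact e.sum_comp (fun i => M i i)

/-- **Reindexing a CONV representation.** If a gate function `g` is represented as an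
SDP-feasibility gate whose constraints are indexed by a finite type `R` and whose matrix variable
is indexed by a finite type `V` (with `B ≥ 0`), then `g` is a CONV gate of every size parameter
`s ≥ #R + #V`: transport the data along `R ≃ Fin #R`, `V ≃ Fin #V`. [folklore] -/
theorem isConvGate_of_indexed {R V : Type*} [Fintype R] [Fintype V] {g : GateFn}
    (A : R → Matrix V V ℝ) (b : R → ℝ) (B : R → Fin g.1 → ℝ) (hB : ∀ r j, 0 ≤ B r j)
    (h : ∀ v : Fin g.1 → Bool, g.2 v = true ↔ ∃ Y : Matrix V V ℝ, Y.PosSemidef ∧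
      ∀ r, (A r * Y).trace ≤ b r + ∑ j, B r j * (if v j then (1 : ℝ) else 0))
    {s : ℕ} (hs : Fintype.card R + Fintype.card V ≤ s) : IsConvGate s g := by
  classical
  set eR := Fintype.equivFin R
  set eV := Fintype.equivFin V
  refine ⟨Fintype.card R, Fintype.card V, hs, fun i => (A (eR.symm i)).submatrix eV.symm eV.symm,
    fun i => b (eR.symm i), fun i j => B (eR.symm i) j, fun i j => hB _ _, fun v => (h v).trans ?_⟩
  constructor
  · rintro ⟨Y, hY, hrows⟩
    refine ⟨Y.submatrix eV.symm eV.symm, hY.submatrix _, fun i => ?_⟩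
    rw [submatrix_mul_equiv, trace_submatrix_of_equiv]
    exact hrows _
  · rintro ⟨Y, hY, hrows⟩
    refine ⟨Y.submatrix eV eV, hY.submatrix _, fun r => ?_⟩
    have key : (A r * Y.submatrix eV eV).trace
        = ((A r).submatrix eV.symm eV.symm * Y).trace := by
      rw [← trace_submatrix_of_equiv ((A r).submatrix eV.symm eV.symm * Y) eV,
        ← submatrix_mul_equiv _ _ _ eV _, Matrix.submatrix_submatrix]
      simp
    have := hrows (eR r)
    simp only [eR, Equiv.symm_apply_apply] at this
    rw [key]
    exact this

/-- **Block-diagonal matrices with positive semidefinite blocks are positive semidefinite**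
(the quadratic form splits as the sum of the blocks' quadratic forms). [folklore] -/
theorem posSemidef_blockDiagonal {m o : Type*} [Fintype m] [DecidableEq m] [Fintype o]
    [DecidableEq o] {M : o → Matrix m m ℝ} (h : ∀ k, (M k).PosSemidef) :
    (blockDiagonal M).PosSemidef := by
  refine PosSemidef.of_dotProduct_mulVec_nonneg (isHermitian_blockDiagonal_iff.2 fun k => (h k).1)
    fun x => ?_
  have key : star x ⬝ᵥ (blockDiagonal M *ᵥ x)
      = ∑ k, star (fun i => x (i, k)) ⬝ᵥ (M k *ᵥ fun i => x (i, k)) := by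
    simp only [dotProduct, mulVec, blockDiagonal_apply', Fintype.sum_prod_type, ite_mul, zero_mul,
      Finset.sum_ite_eq, Finset.mem_univ, if_true, star_trivial]
    rw [Finset.sum_comm]
  rw [key]
  exact Finset.sum_nonneg fun k _ => (h k).dotProduct_mulVec_nonneg _

/-- `tr (E_{vw} 𝒴) = 𝒴_{wv}`. [folklore] -/
theorem trace_single_one_mul {V : Type*} [Fintype V] [DecidableEq V] (v w : V)
    (Y : Matrix V V ℝ) : (single v w (1 : ℝ) * Y).trace = Y w v := by
  rw [trace_single_mul, smul_eq_mul, one_mul]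

/-- Every gate of a circuit over `{∧₂, ∨₂} ∪ CONV_s` is a CONV gate of size parameter
`max s 1` (`∧₂, ∨₂ ∈ CONV₁`). [folklore] -/
theorem isConvGate_of_isOver {ι : Type*} {s : ℕ} (C : Circuit ι)
    (hC : C.IsOver ({GateFn.and 2, GateFn.or 2} ∪ {g | IsConvGate s g})) :
    ∀ g ∈ C.gates, IsConvGate (max s 1) g.fn := by
  intro g hg
  rcases hC g hg with h | h
  · rcases h with h | h
    · rw [h]; exact (and_isConvGate 2).mono (le_max_right _ _)
    · rw [Set.mem_singleton_iff] at h
      rw [h]; exact (or_isConvGate 2).mono (le_max_right _ _)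
  · exact IsConvGate.mono h (le_max_left _ _)

namespace ConvCollapse

variable {ι : Type} {C : Circuit ι}
  (p q : Fin C.gates.length → ℕ)
  (A : (j : Fin C.gates.length) → Fin (p j) → Matrix (Fin (q j)) (Fin (q j)) ℝ)
  (b : (j : Fin C.gates.length) → Fin (p j) → ℝ)
  (B : (j : Fin C.gates.length) → Fin (p j) → Fin (C.gates[j]).fn.1 → ℝ)
  (hB : ∀ j r a, 0 ≤ B j r a)
  (hspec : ∀ (j : Fin C.gates.length) (v : Fin (C.gates[j]).fn.1 → Bool),
    (C.gates[j]).fn.2 v = true ↔ ∃ Y : Matrix (Fin (q j)) (Fin (q j)) ℝ, Y.PosSemidef ∧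
      ∀ r, (A j r * Y).trace ≤ b j r + ∑ a, B j r a * (if v a then (1 : ℝ) else 0))

/-! ### Soundness, for abstract coordinates -/

section Soundness

variable {V : Type*} (Y : Matrix V V ℝ)
  (eY : (j : Fin C.gates.length) → Fin (q j) → V) (vZ : Fin C.gates.length → V)
  (vW : Fin C.gates.length → ι ⊕ Fin C.gates.length → V)
  (tw : Fin C.gates.length → ι ⊕ ℕ → ι ⊕ Fin C.gates.length)

include hB hspec in
/-- **Soundness of the single system.** Let every gate `j` of `C` be a CONV gate with data
`(A j, b j, B j ≥ 0)`, let `tw j` normalise the argument wires of gate `j` (inputs to inputs,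
in-range back-references to gate indices), and let a psd matrix `𝒴` satisfy, at the input `x`,
the homogenised gate rows, `w_{j,u} ≤ z_j`, `w_{j,e} ≤ [x_e]`, `w_{j,m} ≤ z_m` and the output row
(`z_out ≥ 1`, resp. `x_e = 1` if the output is the input wire `e`). Then `C` accepts `x`.
Proof: by strong induction along the program, a gate of positive level `z_j` is true — its block
divided by `z_j` is feasible for the gate's own system because `w_{j,u} / z_j ≤ [value of u]`
(false earlier gates have level `0` by induction, and `B ≥ 0`). [folklore] -/
theorem eval_of_levels (hY : Y.PosSemidef)
    (htw_inl : ∀ j e, tw j (.inl e) = .inl e)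
    (htw_inr : ∀ j m (hm : m < C.gates.length), tw j (.inr m) = .inr ⟨m, hm⟩)
    (x : ι → Bool)
    (hG : ∀ j r, (A j r * Y.submatrix (eY j) (eY j)).trace ≤ b j r * Y (vZ j) (vZ j) +
      ∑ a, B j r a * Y (vW j (tw j ((C.gates[j]).args a))) (vW j (tw j ((C.gates[j]).args a))))
    (hZ : ∀ j u, Y (vW j u) (vW j u) ≤ Y (vZ j) (vZ j))
    (hI : ∀ j e, Y (vW j (.inl e)) (vW j (.inl e)) ≤ if x e then (1 : ℝ) else 0)
    (hR : ∀ j m, Y (vW j (.inr m)) (vW j (.inr m)) ≤ Y (vZ m) (vZ m))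
    (hO : ∀ m (hm : m < C.gates.length), C.output = .inr m → 1 ≤ Y (vZ ⟨m, hm⟩) (vZ ⟨m, hm⟩))
    (hO' : ∀ e, C.output = .inl e → x e = true) :
    C.eval x = true := by
  set W := transcript x [] C.gates with hW
  have hdiag : ∀ v, 0 ≤ Y v v := fun v => hY.diag_nonneg
  -- the level of a gate is positive only if the gate is true
  have claim : ∀ m (hm : m < C.gates.length),
      0 < Y (vZ ⟨m, hm⟩) (vZ ⟨m, hm⟩) → W.getD m false = true := by
    intro m
    induction m using Nat.strong_induction_on with
    | _ m ih =>
      intro hm hz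
      set j : Fin C.gates.length := ⟨m, hm⟩ with hj
      rw [hW, getD_transcript_eq_gateValue C x m hm, ← hW]
      change (C.gates[j]).fn.2 (fun a => wireVal x W ((C.gates[j]).args a)) = true
      refine (hspec j _).2 ⟨(Y (vZ j) (vZ j))⁻¹ • Y.submatrix (eY j) (eY j),
        (hY.submatrix _).smul (inv_nonneg.2 (hdiag _)), fun r => ?_⟩
      have hrow := hG j r
      rw [Matrix.mul_smul, trace_smul, smul_eq_mul]
      set z := Y (vZ j) (vZ j) with hzdef
      have hzinv : 0 ≤ z⁻¹ := inv_nonneg.2 (hdiag _)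
      -- each linearised product is dominated by the value of its wire
      have hw : ∀ a : Fin (C.gates[j]).fn.1,
          z⁻¹ * Y (vW j (tw j ((C.gates[j]).args a))) (vW j (tw j ((C.gates[j]).args a)))
            ≤ (if wireVal x W ((C.gates[j]).args a) then (1 : ℝ) else 0) := by
        intro a
        have hself := hZ j (tw j ((C.gates[j]).args a))
        rcases hargs : (C.gates[j]).args a with e | m'
        · -- an input wire
          rw [hargs, htw_inl] at hself
          have hin := hI j e
          simp only [htw_inl, wireVal]
          by_cases hxe : x e = true
          · rw [if_pos hxe] at hin ⊢
            calc z⁻¹ * Y (vW j (.inl e)) (vW j (.inl e)) ≤ z⁻¹ * z :=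
                  mul_le_mul_of_nonneg_left hself hzinv
              _ = 1 := inv_mul_cancel₀ (ne_of_gt hz)
          · rw [if_neg hxe] at hin ⊢
            exact mul_nonpos_of_nonneg_of_nonpos hzinv hin
        · -- a back-reference to an earlier gate
          have hm' : m' < m := C.wf m hm a m' hargs
          have hm'len : m' < C.gates.length := hm'.trans hm
          rw [hargs, htw_inr j m' hm'len] at hself
          have href := hR j ⟨m', hm'len⟩
          simp only [htw_inr j m' hm'len, wireVal]
          by_cases hval : W.getD m' false = true
          · rw [if_pos hval]
            calc z⁻¹ * Y (vW j (.inr ⟨m', hm'len⟩)) (vW j (.inr ⟨m', hm'len⟩)) ≤ z⁻¹ * z :=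
                  mul_le_mul_of_nonneg_left hself hzinv
              _ = 1 := inv_mul_cancel₀ (ne_of_gt hz)
          · rw [if_neg hval]
            have hzm : ¬ 0 < Y (vZ ⟨m', hm'len⟩) (vZ ⟨m', hm'len⟩) := fun hpos =>
              hval (ih m' hm' hm'len hpos)
            exact mul_nonpos_of_nonneg_of_nonpos hzinv (by linarith [not_lt.1 hzm])
      -- combine
      set S := ∑ a, B j r a *
        Y (vW j (tw j ((C.gates[j]).args a))) (vW j (tw j ((C.gates[j]).args a))) with hSdef
      have hS : z⁻¹ * S = ∑ a, B j r a *
          (z⁻¹ * Y (vW j (tw j ((C.gates[j]).args a))) (vW j (tw j ((C.gates[j]).args a)))) := by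
        rw [hSdef, Finset.mul_sum]
        exact Finset.sum_congr rfl fun a _ => by ring
      have hsum : ∑ a, B j r a *
            (z⁻¹ * Y (vW j (tw j ((C.gates[j]).args a))) (vW j (tw j ((C.gates[j]).args a))))
          ≤ ∑ a, B j r a * (if wireVal x W ((C.gates[j]).args a) then (1 : ℝ) else 0) :=
        Finset.sum_le_sum fun a _ => mul_le_mul_of_nonneg_left (hw a) (hB j r a)
      have hbz : z⁻¹ * (b j r * z) = b j r := by field_simp
      calc z⁻¹ * (A j r * Y.submatrix (eY j) (eY j)).trace
          ≤ z⁻¹ * (b j r * z + S) := mul_le_mul_of_nonneg_left hrow hzinv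
        _ = b j r + z⁻¹ * S := by rw [mul_add, hbz]
        _ ≤ _ := by rw [hS]; linarith
  -- the output row
  rw [eval_eq_wireVal, ← hW]
  rcases hC : C.output with e | m
  · exact hO' e hC
  · have hm : m < C.gates.length := C.wf_output m hC
    exact claim m hm (by linarith [hO m hm hC])

end Soundness

/-! ### Completeness, on concrete block coordinates -/

section Completeness

variable [Fintype ι] [DecidableEq ι]
  (tw : Fin C.gates.length → ι ⊕ ℕ → ι ⊕ Fin C.gates.length)

include hspec in
/-- **Completeness of the single system.** Let every gate of `C` be a CONV gate with data
`(A j, b j, B j)` and `q j ≤ Q`. Index the matrix variable by `Fin (Q+1) × Slot`,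
`Slot = gates ⊕ (gates ⊕ gates × wires)`: the `Y`-block of gate `j` sits at
`(Fin.castLE _ i, inl j)`, the level `z_j` at `(0, inr (inl j))`, the product `w_{j,u}` at
`(0, inr (inr (j, u)))`. If `C` accepts `x`, the block-diagonal matrix carrying the feasibility
witnesses of the TRUE gates (false gates: `0`), levels `z_j = [gate j true]` and products
`w_{j,u} = [gate j true ∧ wire u true]` is psd and satisfies every row of the homogenised system
at `x`. [folklore] -/
theorem exists_feasible {Q : ℕ} (hQ : ∀ j, q j ≤ Q)
    (htw_inl : ∀ j e, tw j (.inl e) = .inl e)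
    (htw_inr : ∀ j m (hm : m < C.gates.length), tw j (.inr m) = .inr ⟨m, hm⟩)
    (x : ι → Bool) (hx : C.eval x = true) :
    ∃ Y : Matrix (Fin (Q + 1) × (Fin C.gates.length ⊕ (Fin C.gates.length ⊕
        (Fin C.gates.length × (ι ⊕ Fin C.gates.length)))))
      (Fin (Q + 1) × (Fin C.gates.length ⊕ (Fin C.gates.length ⊕
        (Fin C.gates.length × (ι ⊕ Fin C.gates.length))))) ℝ,
      Y.PosSemidef ∧
      (∀ j r, (A j r * Y.submatrix (fun i => (Fin.castLE (Nat.le_succ_of_le (hQ j)) i, Sum.inl j))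
          (fun i => (Fin.castLE (Nat.le_succ_of_le (hQ j)) i, Sum.inl j))).trace ≤
        b j r * Y (0, .inr (.inl j)) (0, .inr (.inl j)) +
          ∑ a, B j r a * Y (0, .inr (.inr (j, tw j ((C.gates[j]).args a))))
            (0, .inr (.inr (j, tw j ((C.gates[j]).args a))))) ∧
      (∀ j u, Y (0, .inr (.inr (j, u))) (0, .inr (.inr (j, u))) ≤
        Y (0, .inr (.inl j)) (0, .inr (.inl j))) ∧
      (∀ j (e : ι), Y (0, .inr (.inr (j, .inl e))) (0, .inr (.inr (j, .inl e))) ≤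
        if x e then (1 : ℝ) else 0) ∧
      (∀ j m, Y (0, .inr (.inr (j, .inr m))) (0, .inr (.inr (j, .inr m))) ≤
        Y (0, .inr (.inl m)) (0, .inr (.inl m))) ∧
      (∀ m (hm : m < C.gates.length), C.output = .inr m →
        1 ≤ Y (0, .inr (.inl ⟨m, hm⟩)) (0, .inr (.inl ⟨m, hm⟩))) := by
  set W := transcript x [] C.gates with hW
  -- values of wires
  set val : ι ⊕ Fin C.gates.length → Bool := Sum.elim x (fun m => W.getD m false) with hval
  have hvalw : ∀ (j : Fin C.gates.length) (a : Fin (C.gates[j]).fn.1),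
      val (tw j ((C.gates[j]).args a)) = wireVal x W ((C.gates[j]).args a) := by
    intro j a
    rcases hargs : (C.gates[j]).args a with e | m'
    · simp [htw_inl, hval, wireVal]
    · have hm' : m' < C.gates.length := (C.wf j j.isLt a m' hargs).trans j.isLt
      rw [htw_inr j m' hm']
      simp [hval, wireVal]
  -- witnesses of the true gates
  have hwit : ∀ j : Fin C.gates.length, ∃ Yj : Matrix (Fin (q j)) (Fin (q j)) ℝ,
      Yj.PosSemidef ∧ (W.getD j false = true → ∀ r, (A j r * Yj).trace ≤
        b j r + ∑ a, B j r a * (if wireVal x W ((C.gates[j]).args a) then (1 : ℝ) else 0)) := by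
    intro j
    by_cases hj : W.getD j false = true
    · have hgate : (C.gates[j]).fn.2 (fun a => wireVal x W ((C.gates[j]).args a)) = true := by
        rw [hW, getD_transcript_eq_gateValue C x j j.isLt, ← hW] at hj
        exact hj
      obtain ⟨Yj, hYj, hr⟩ := (hspec j _).1 hgate
      exact ⟨Yj, hYj, fun _ => hr⟩
    · exact ⟨0, PosSemidef.zero, fun h => absurd h hj⟩
  choose Yw hYw hYrows using hwit
  -- the block-diagonal feasible point
  set zv : Fin C.gates.length → ℝ := fun j => if W.getD j false then 1 else 0 with hzv
  set wv : Fin C.gates.length → ι ⊕ Fin C.gates.length → ℝ :=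
    fun j u => if W.getD j false && val u then 1 else 0 with hwv
  have hzv0 : ∀ j, 0 ≤ zv j := fun j => by simp only [hzv]; split_ifs <;> norm_num
  have hwv0 : ∀ j u, 0 ≤ wv j u := fun j u => by simp only [hwv]; split_ifs <;> norm_num
  -- clamping `Fin (Q+1)` onto `Fin (q j)`, a left inverse of the block embedding
  set clamp : (j : Fin C.gates.length) → 0 < q j → Fin (Q + 1) → Fin (q j) :=
    fun j hq a => ⟨min a.val (q j - 1), by omega⟩ with hclamp
  have hclamp_cast : ∀ j (hq : 0 < q j) (i : Fin (q j)),
      clamp j hq (Fin.castLE (Nat.le_succ_of_le (hQ j)) i) = i := by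
    intro j hq i
    ext
    simp only [hclamp, Fin.val_castLE]
    omega
  set blk : (Fin C.gates.length ⊕ (Fin C.gates.length ⊕
      (Fin C.gates.length × (ι ⊕ Fin C.gates.length)))) → Matrix (Fin (Q + 1)) (Fin (Q + 1)) ℝ :=
    fun σ => match σ with
    | .inl j => if h : 0 < q j then zv j • (Yw j).submatrix (clamp j h) (clamp j h) else 0
    | .inr (.inl j) => zv j • (1 : Matrix (Fin (Q + 1)) (Fin (Q + 1)) ℝ)
    | .inr (.inr (j, u)) => wv j u • (1 : Matrix (Fin (Q + 1)) (Fin (Q + 1)) ℝ) with hblk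
  have hpsd : ∀ σ, (blk σ).PosSemidef := by
    rintro (j | j | ⟨j, u⟩)
    · simp only [hblk]
      split_ifs with h
      · exact ((hYw j).submatrix _).smul (hzv0 j)
      · exact PosSemidef.zero
    · exact PosSemidef.one.smul (hzv0 j)
    · exact PosSemidef.one.smul (hwv0 j u)
  -- entries of the feasible point
  have hY_block : ∀ j, (blockDiagonal blk).submatrix
      (fun i => (Fin.castLE (Nat.le_succ_of_le (hQ j)) i, Sum.inl j))
      (fun i => (Fin.castLE (Nat.le_succ_of_le (hQ j)) i, Sum.inl j)) = zv j • Yw j := by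
    intro j
    ext i i'
    have hq : 0 < q j := Fin.pos i
    simp only [Matrix.submatrix_apply, blockDiagonal_apply_eq, hblk, hq, ↓reduceDIte,
      Matrix.smul_apply, hclamp_cast]
  have hY_z : ∀ j, blockDiagonal blk (0, .inr (.inl j)) (0, .inr (.inl j)) = zv j := by
    intro j
    simp [blockDiagonal_apply_eq, hblk]
  have hY_w : ∀ j u, blockDiagonal blk (0, .inr (.inr (j, u))) (0, .inr (.inr (j, u))) = wv j u := by
    intro j u
    simp [blockDiagonal_apply_eq, hblk]
  have hb1 : ∀ c d : Bool, (if (c && d) = true then (1 : ℝ) else 0) ≤ (if d = true then 1 else 0) := by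
    rintro (_ | _) (_ | _) <;> norm_num
  have hb2 : ∀ c d : Bool, (if (c && d) = true then (1 : ℝ) else 0) ≤ (if c = true then 1 else 0) := by
    rintro (_ | _) (_ | _) <;> norm_num
  refine ⟨blockDiagonal blk, posSemidef_blockDiagonal hpsd, ?_, ?_, ?_, ?_, ?_⟩
  · -- gate rows
    intro j r
    rw [hY_block, hY_z]
    simp only [hY_w]
    by_cases hj : W.getD j false = true
    · have hz1 : zv j = 1 := if_pos hj
      have hw1 : ∀ a : Fin (C.gates[j]).fn.1, wv j (tw j ((C.gates[j]).args a)) =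
          (if wireVal x W ((C.gates[j]).args a) then (1 : ℝ) else 0) := by
        intro a
        rw [← hvalw j a]
        show (if (W.getD j false && _) = true then (1 : ℝ) else 0) = _
        rw [hj, Bool.true_and]
      simp only [hz1, one_smul, mul_one, hw1]
      exact hYrows j hj r
    · have hz0 : zv j = 0 := if_neg hj
      have hj' : W.getD j false = false := eq_false_of_ne_true hj
      have hw0 : ∀ u, wv j u = 0 := fun u => by
        show (if (W.getD j false && _) = true then (1 : ℝ) else 0) = 0
        rw [hj', Bool.false_and]
        exact if_neg Bool.false_ne_true
      simp [hz0, hw0]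
  · -- rows `w_{j,u} ≤ z_j`
    intro j u
    rw [hY_w, hY_z]
    exact hb2 _ _
  · -- rows `w_{j,e} ≤ [x_e]`
    intro j e
    rw [hY_w]
    exact hb1 _ _
  · -- rows `w_{j,m} ≤ z_m`
    intro j m
    rw [hY_w, hY_z]
    exact hb1 _ _
  · -- the output row
    intro m hm hC
    rw [eval_eq_wireVal, ← hW, hC] at hx
    change W.getD m false = true at hx
    have hz1 : zv ⟨m, hm⟩ = 1 := if_pos hx
    rw [hY_z, hz1]

end Completeness

end ConvCollapse

end Summit.PneNP.PneNP.Theorems
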